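/-
Copyright (c) 2026 the pub-hodgecm-mathlib formalisation cell (harness21).  Prover seat hodgecm-mathlib-K2E3-p12 (g5), Track B «K2-LIT» ∕ h413
(`stmt-HodgeConjecture-24833`), line `K2_E3_EllipticInputs`, unit U12-d, §L (G⁺-b)∕(K5d): (LBGL-2b-Tw) «the χ̃-twisted regular nilpotent Fourier transform is a
regular function» FROM THE THREE K-AVERAGE INPUTS (bridge to the cell integrals, uniform domination, uniform local constancy).  2026-09-04.
-/
import Summits.HodgeConjecture.HodgeConjecture.Theorems.K2E3GL2TwistedNilpotentFourierChain          -- (K5c) (this seat): the chain identity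
import Summits.HodgeConjecture.HodgeConjecture.Theorems.K2E3GL2RegularSetLimitDensity                -- ★ p857620 (K5a) (this seat): limit density
import Summits.HodgeConjecture.HodgeConjecture.Theorems.K2E3GL2BorelSliceLowerCell                   -- ★ p857112 (K2E5-p10 g4): `discr_charpoly_fin_two_explicit`
import HarnessLib

/-!
# K2_E3 road (h413), §L — (G⁺-b)∕(K5d): (LBGL-2b-Tw) from the bridge, the domination and the local constancy of the twisted `K`-averages

Cell `pub/hodgecm-mathlib` (D-0151), Track B, seat K2E3-p12 (g5), §L line lead (road «U-iso-T»).  `--supports stmt-HodgeConjecture-24833 --as helper`; THEOREMS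
ONLY (no definition ∕ instance ∕ notation ∕ named fact ∕ `sorry`); never imports `Cruxes/…/Lines`.  Count-neutral: the hosted leaf (LBGL-2b-Tw)
`sig_K2E3GL2TwistedRegularNilpotentFourier` (U12 ED. 14 :797) is paid by ONE application of the head below once its three hypotheses are ★
((K4-b⁺) = `hbridge` + `hbound`, (K4-c) = `hlc`; frozen currency of the bus 05:25Z).

* §1 `truncIntegral_eventually_const_of_isUnit_discr` — ★ (K4-a) `exists_forall_truncIntegral_eq` for the two cell quadratics `P_X`, `Q_X` of a regular `X`
  (`disc P_X = disc Q_X = disc χ_X`, ★ `discr_charpoly_fin_two_explicit`); **`twistedKAverage_eventually_const`** — through the bridge, `A_n(X)` is eventually constant.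
* §2 **`twistedRegularNilpotentFourier_of_KAverage`** — THE HEAD: for `(F, ψ, χ, μ𝔤, κ, dx)` with `χ` quadratic non-trivial, IF
  `hbridge : ∃ c_B > 0, ∀ n X, A_n X = c_B·(B_n(𝒪; P_X) + χ̃(−1)·B_n(𝔭; Q_X))`, `hbound : ∃ C, ∀ n X, disc χ_X ≠ 0 → ‖A_n X‖ ≤ C·|disc χ_X|^{-1∕2}` and
  `hlc : ∀ X₀ regular, ∀ᶠ X, ∀ n, A_n X = A_n X₀`, THEN the (LBGL-2b-Tw) body holds: `∃ Fr` locally integrable with `∫ χ̃(t·det k)·𝓕f(k·tE₁₂·k⁻¹) = ∫ f·Fr`,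
  `Fr` locally constant on the regular set, `|disc|^{1∕2}·‖Fr‖` locally bounded — `Fr = c·γ₀·c′·Fr_Z + c·γ₀·c₀·Fr₀` ((K5a) limit density of `A_n` ★ + (K5c) chain ★:
  the sequence `c·γ₀·c′·∫ f·A_n + c·γ₀·c₀·∫ f·Fr₀` is eventually equal to the left-hand side and converges to `∫ f·Fr`).

HONEST LABEL: HC_CM is proved only modulo the 7 printed citations (2 remaining named inputs: hLiu418 = stmt-HodgeConjecture-24832, h413 = stmt-HodgeConjecture-24833)
until rung 0 closes; count-neutral plumbing (hypotheses `hbridge`∕`hbound`∕`hlc` are (K4-b⁺)∕(K4-c), NOT ★ yet).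

References: [HarishChandra1999AdmissibleDistributions] Harish-Chandra (DeBacker–Sally) (1999), Thm. 4.4 p. 11, Lemma 5.2, §7, Lemma 7.8; [LabesseLanglands1979] §2, §5.
-/

set_option autoImplicit false
set_option linter.dupNamespace false   -- `Summit.HodgeConjecture.HodgeConjecture.…` (D-0017 nested layout; lakefile exemption for Summits)

noncomputable section

open MeasureTheory Measure Filter Topology TopologicalSpace Set
open scoped MatrixGroups NNReal ENNReal
open Literature.NumberTheory.Rogawski1990 Literature.NumberTheory.Automorphic Literature.NumberTheory.Automorphic.LocalFieldHaar
open Literature.NumberTheory.GaloisRepresentations Literature.NumberTheory.GaloisRepresentations.IsNonarchimedeanLocalField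
open Summit.HodgeConjecture.HodgeConjecture.Cruxes.H413.K2E3LocalFieldQuadraticWeightEventuallyConst (norm_truncWeight_le exists_forall_truncIntegral_eq)
open Summit.HodgeConjecture.HodgeConjecture.Cruxes.H413.K2E3GL2BorelSliceLowerCell (discr_charpoly_fin_two_explicit)
open Summit.HodgeConjecture.HodgeConjecture.Cruxes.H413.K2E3GL2RegularSetLimitDensity (exists_limitDensity_of_eventually_const)
open Summit.HodgeConjecture.HodgeConjecture.Cruxes.H413.K2E3GL2TwistedKAverage
open Summit.HodgeConjecture.HodgeConjecture.Cruxes.H413.K2E3GL2TwistedNilpotentFourierChain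

namespace Summit.HodgeConjecture.HodgeConjecture.Cruxes.H413.K2E3GL2TwistedRegularNilpotentFourierOfKAverage

variable {F : Type*} [Field F] [ValuativeRel F] [TopologicalSpace F] [IsNonarchimedeanLocalField F] [MeasurableSpace F] [BorelSpace F]
  (dx : Measure F) [dx.IsAddHaarMeasure] (χ : QuasiChar F)

/-! ## §1  Eventual constancy of the twisted `K`-averages through the bridge -/

omit [ValuativeRel F] [TopologicalSpace F] [IsNonarchimedeanLocalField F] [MeasurableSpace F] [BorelSpace F] in
/-- `disc P_X = disc χ_X` for the lower cell quadratic `P_X(σ) = X₁₀ + (X₁₁ − X₀₀)σ − X₀₁σ²`. [folklore] -/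
theorem discr_lowerCell_eq (X : Matrix (Fin 2) (Fin 2) F) :
    (X 1 1 - X 0 0) ^ 2 - 4 * X 1 0 * (-X 0 1) = X.charpoly.discr := by
  have h := discr_charpoly_fin_two_explicit (X 0 0) (X 0 1) (X 1 0) (X 1 1)
  have hX : (!![X 0 0, X 0 1; X 1 0, X 1 1] : Matrix (Fin 2) (Fin 2) F) = X := (Matrix.eta_fin_two X).symm
  rw [hX] at h
  rw [h]; ring

omit [ValuativeRel F] [TopologicalSpace F] [IsNonarchimedeanLocalField F] [MeasurableSpace F] [BorelSpace F] in
/-- `disc Q_X = disc χ_X` for the upper cell quadratic `Q_X(t) = X₀₁ + (X₀₀ − X₁₁)t − X₁₀t²`. [folklore] -/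
theorem discr_upperCell_eq (X : Matrix (Fin 2) (Fin 2) F) :
    (X 0 0 - X 1 1) ^ 2 - 4 * X 0 1 * (-X 1 0) = X.charpoly.discr := by
  have h := discr_charpoly_fin_two_explicit (X 0 0) (X 0 1) (X 1 0) (X 1 1)
  have hX : (!![X 0 0, X 0 1; X 1 0, X 1 1] : Matrix (Fin 2) (Fin 2) F) = X := (Matrix.eta_fin_two X).symm
  rw [hX] at h
  rw [h]; ring

/-- **`A_n(X)` IS EVENTUALLY CONSTANT AT A REGULAR `X`** through the bridge `A_n X = c_B·(B_n(𝒪; P_X) + χ̃(−1)·B_n(𝔭; Q_X))` and ★ (K4-a)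
`exists_forall_truncIntegral_eq` (`disc P_X = disc Q_X = disc χ_X ≠ 0`). [cite: HarishChandra1999AdmissibleDistributions, §7] -/
theorem twistedKAverage_eventually_const [CharZero F] (hχ2 : ∀ u, χ u * χ u = 1) (hχ1 : ∃ u, χ u ≠ 1)
    (A : ℕ → Matrix (Fin 2) (Fin 2) F → ℂ) {cB : ℝ}
    (hbridge : ∀ (n : ℕ) (X : Matrix (Fin 2) (Fin 2) F), A n X = (cB : ℂ) *
      ((∫ σ in primePowBall F 0, (primePowBall F (2 * (n : ℤ)))ᶜ.indicator
          (fun y => Function.extend ((↑) : Fˣ → F) (fun u => ((χ u : ℂˣ) : ℂ)) 0 y * ((((normAbs F y)⁻¹ : ℝ≥0) : ℝ) : ℂ))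
          (X 1 0 + (X 1 1 - X 0 0) * σ + (-X 0 1) * σ ^ 2) ∂dx) +
        Function.extend ((↑) : Fˣ → F) (fun u => ((χ u : ℂˣ) : ℂ)) 0 (-1) *
          ∫ σ in primePowBall F 1, (primePowBall F (2 * (n : ℤ)))ᶜ.indicator
            (fun y => Function.extend ((↑) : Fˣ → F) (fun u => ((χ u : ℂˣ) : ℂ)) 0 y * ((((normAbs F y)⁻¹ : ℝ≥0) : ℝ) : ℂ))
            (X 0 1 + (X 0 0 - X 1 1) * σ + (-X 1 0) * σ ^ 2) ∂dx))
    (X : Matrix (Fin 2) (Fin 2) F) (hX : IsUnit X.charpoly.discr) :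
    ∃ n₀ : ℕ, ∀ n : ℕ, n₀ ≤ n → A n X = A n₀ X := by
  have h2 : (2 : F) ≠ 0 := two_ne_zero
  have hP : (X 1 1 - X 0 0) ^ 2 - 4 * X 1 0 * (-X 0 1) ≠ 0 := by rw [discr_lowerCell_eq]; exact isUnit_iff_ne_zero.1 hX
  have hQ : (X 0 0 - X 1 1) ^ 2 - 4 * X 0 1 * (-X 1 0) ≠ 0 := by rw [discr_upperCell_eq]; exact isUnit_iff_ne_zero.1 hX
  obtain ⟨n₁, hn₁⟩ := exists_forall_truncIntegral_eq dx h2 χ hχ2 hχ1 0 hP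
  obtain ⟨n₂, hn₂⟩ := exists_forall_truncIntegral_eq dx h2 χ hχ2 hχ1 1 hQ
  refine ⟨max n₁ n₂, fun n hn => ?_⟩
  rw [hbridge n X, hbridge (max n₁ n₂) X, hn₁ n (le_trans (le_max_left _ _) hn), hn₁ (max n₁ n₂) (le_max_left _ _),
    hn₂ n (le_trans (le_max_right _ _) hn), hn₂ (max n₁ n₂) (le_max_right _ _)]

/-! ## §2  The head: (LBGL-2b-Tw) from the three `K`-average inputs -/

/-- **(LBGL-2b-Tw) FROM THE BRIDGE, THE DOMINATION AND THE LOCAL CONSTANCY OF THE TWISTED `K`-AVERAGES.**  For a non-archimedean local `F` of characteristic `0`,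
continuous non-trivial `ψ`, quadratic non-trivial `χ`, Haar data `(μ𝔤, κ, dx)`: IF the truncated twisted `K`-averages `A_n` satisfy the bridge identity
`hbridge` (★ (K3±) cell formula), the uniform domination `hbound` (`‖A_n X‖ ≤ C·|disc χ_X|^{-1∕2}` on the regular set) and the uniform local constancy `hlc`,
THEN the `χ̃(t·det k)`-twisted regular nilpotent orbital integral composed with `𝓕_ψ` is represented by a locally integrable `Fr`, locally constant on the
regular set, with `|disc|^{1∕2}·‖Fr‖` locally bounded (`Fr = c·γ₀·c′·Fr_Z + c·γ₀·c₀·Fr₀`, ★ (K5a) + ★ (K5c)).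
[cite: HarishChandra1999AdmissibleDistributions, Thm. 4.4 p. 11, Lemma 5.2, Lemma 7.8] [cite: LabesseLanglands1979, §5] -/
theorem twistedRegularNilpotentFourier_of_KAverage [CharZero F] {ψ : AddChar F Circle} (hψ : ψ.IsContinuousNontrivial) (hχ2 : ∀ u, χ u * χ u = 1)
    (hχ1 : ∃ u, χ u ≠ 1) [MeasurableSpace (GL (Fin 2) F)] [BorelSpace (GL (Fin 2) F)] [MeasurableSpace (Matrix (Fin 2) (Fin 2) F)] [BorelSpace (Matrix (Fin 2) (Fin 2) F)]
    (μ𝔤 : Measure (Matrix (Fin 2) (Fin 2) F)) [μ𝔤.IsAddHaarMeasure] (κ : Measure ↥(glInt 2 F)) [IsHaarMeasure κ]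
    (hbridge : ∃ cB : ℝ, 0 < cB ∧ ∀ (n : ℕ) (X : Matrix (Fin 2) (Fin 2) F),
      ∫ k : ↥(glInt 2 F), Function.extend ((↑) : Fˣ → F) (fun u => ((χ u : ℂˣ) : ℂ)) 0 (((k : GL (Fin 2) F) : Matrix (Fin 2) (Fin 2) F)).det *
          (primePowBall F (2 * (n : ℤ)))ᶜ.indicator
            (fun y => Function.extend ((↑) : Fˣ → F) (fun u => ((χ u : ℂˣ) : ℂ)) 0 y * ((((normAbs F y)⁻¹ : ℝ≥0) : ℝ) : ℂ))
            ((((((k : GL (Fin 2) F))⁻¹ : GL (Fin 2) F) : Matrix (Fin 2) (Fin 2) F) * X * ((k : GL (Fin 2) F) : Matrix (Fin 2) (Fin 2) F)) 1 0) ∂κ =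
        (cB : ℂ) *
          ((∫ σ in primePowBall F 0, (primePowBall F (2 * (n : ℤ)))ᶜ.indicator
              (fun y => Function.extend ((↑) : Fˣ → F) (fun u => ((χ u : ℂˣ) : ℂ)) 0 y * ((((normAbs F y)⁻¹ : ℝ≥0) : ℝ) : ℂ))
              (X 1 0 + (X 1 1 - X 0 0) * σ + (-X 0 1) * σ ^ 2) ∂dx) +
            Function.extend ((↑) : Fˣ → F) (fun u => ((χ u : ℂˣ) : ℂ)) 0 (-1) *
              ∫ σ in primePowBall F 1, (primePowBall F (2 * (n : ℤ)))ᶜ.indicator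
                (fun y => Function.extend ((↑) : Fˣ → F) (fun u => ((χ u : ℂˣ) : ℂ)) 0 y * ((((normAbs F y)⁻¹ : ℝ≥0) : ℝ) : ℂ))
                (X 0 1 + (X 0 0 - X 1 1) * σ + (-X 1 0) * σ ^ 2) ∂dx))
    (hbound : ∃ C : ℝ, ∀ (n : ℕ) (X : Matrix (Fin 2) (Fin 2) F), IsUnit X.charpoly.discr →
      ‖∫ k : ↥(glInt 2 F), Function.extend ((↑) : Fˣ → F) (fun u => ((χ u : ℂˣ) : ℂ)) 0 (((k : GL (Fin 2) F) : Matrix (Fin 2) (Fin 2) F)).det *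
          (primePowBall F (2 * (n : ℤ)))ᶜ.indicator
            (fun y => Function.extend ((↑) : Fˣ → F) (fun u => ((χ u : ℂˣ) : ℂ)) 0 y * ((((normAbs F y)⁻¹ : ℝ≥0) : ℝ) : ℂ))
            ((((((k : GL (Fin 2) F))⁻¹ : GL (Fin 2) F) : Matrix (Fin 2) (Fin 2) F) * X * ((k : GL (Fin 2) F) : Matrix (Fin 2) (Fin 2) F)) 1 0) ∂κ‖ ≤
        C * (((NNReal.sqrt (normAbs F X.charpoly.discr))⁻¹ : ℝ≥0) : ℝ))
    (hlc : ∀ X₀ : Matrix (Fin 2) (Fin 2) F, IsUnit X₀.charpoly.discr → ∀ᶠ X in 𝓝 X₀, ∀ n : ℕ,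
      ∫ k : ↥(glInt 2 F), Function.extend ((↑) : Fˣ → F) (fun u => ((χ u : ℂˣ) : ℂ)) 0 (((k : GL (Fin 2) F) : Matrix (Fin 2) (Fin 2) F)).det *
          (primePowBall F (2 * (n : ℤ)))ᶜ.indicator
            (fun y => Function.extend ((↑) : Fˣ → F) (fun u => ((χ u : ℂˣ) : ℂ)) 0 y * ((((normAbs F y)⁻¹ : ℝ≥0) : ℝ) : ℂ))
            ((((((k : GL (Fin 2) F))⁻¹ : GL (Fin 2) F) : Matrix (Fin 2) (Fin 2) F) * X * ((k : GL (Fin 2) F) : Matrix (Fin 2) (Fin 2) F)) 1 0) ∂κ =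
      ∫ k : ↥(glInt 2 F), Function.extend ((↑) : Fˣ → F) (fun u => ((χ u : ℂˣ) : ℂ)) 0 (((k : GL (Fin 2) F) : Matrix (Fin 2) (Fin 2) F)).det *
          (primePowBall F (2 * (n : ℤ)))ᶜ.indicator
            (fun y => Function.extend ((↑) : Fˣ → F) (fun u => ((χ u : ℂˣ) : ℂ)) 0 y * ((((normAbs F y)⁻¹ : ℝ≥0) : ℝ) : ℂ))
            ((((((k : GL (Fin 2) F))⁻¹ : GL (Fin 2) F) : Matrix (Fin 2) (Fin 2) F) * X₀ * ((k : GL (Fin 2) F) : Matrix (Fin 2) (Fin 2) F)) 1 0) ∂κ) :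
    ∃ Fr : Matrix (Fin 2) (Fin 2) F → ℂ, LocallyIntegrable Fr μ𝔤 ∧
      (∀ f : Matrix (Fin 2) (Fin 2) F → ℂ, IsLocSmooth f →
        ∫ p : ↥(glInt 2 F) × F, Function.extend ((↑) : Fˣ → F) (fun u => ((χ u : ℂˣ) : ℂ)) 0 (p.2 * (((p.1 : GL (Fin 2) F) : Matrix (Fin 2) (Fin 2) F)).det) *
          (fun Y : Matrix (Fin 2) (Fin 2) F => ∫ X, ((ψ (Matrix.trace (Y * X)) : Circle) : ℂ) * f X ∂μ𝔤)
            (((p.1 : GL (Fin 2) F) : Matrix (Fin 2) (Fin 2) F) * !![0, p.2; 0, 0] * ((((p.1 : GL (Fin 2) F))⁻¹ : GL (Fin 2) F) : Matrix (Fin 2) (Fin 2) F)) ∂(κ.prod dx) =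
          ∫ X, f X * Fr X ∂μ𝔤) ∧
      (∀ X : Matrix (Fin 2) (Fin 2) F, IsUnit X.charpoly.discr → ∀ᶠ Y in 𝓝 X, Fr Y = Fr X) ∧
      (∀ C : Set (Matrix (Fin 2) (Fin 2) F), IsCompact C → ∃ B : ℝ, ∀ X ∈ C,
          ((NNReal.sqrt (normAbs F X.charpoly.discr) : ℝ≥0) : ℝ) * ‖Fr X‖ ≤ B) := by
  haveI : T2Space F := (isLocalField F).toT2Space
  haveI : LocallyCompactSpace F := (isLocalField F).toLocallyCompactSpace
  haveI : LocallyCompactSpace (Matrix (Fin 2) (Fin 2) F) := Pi.locallyCompactSpace_of_finite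
  haveI : BorelSpace ↥(glInt 2 F) := Subtype.borelSpace _
  haveI : CompactSpace ↥(glInt 2 F) := isCompact_iff_compactSpace.1 (isCompact_glInt 2 F)
  haveI : IsFiniteMeasure κ := CompactSpace.isFiniteMeasure
  obtain ⟨cB, -, hbridge⟩ := hbridge
  obtain ⟨C, hbound⟩ := hbound
  -- measurability of the weights `ω_n`
  have hωm : ∀ n : ℕ, Measurable fun y : F => (primePowBall F (2 * (n : ℤ)))ᶜ.indicator
      (fun y => Function.extend ((↑) : Fˣ → F) (fun u => ((χ u : ℂˣ) : ℂ)) 0 y * ((((normAbs F y)⁻¹ : ℝ≥0) : ℝ) : ℂ)) y := fun n => by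
    have := measurable_truncWeight_add_indicator χ n 0
    simpa only [zero_mul, add_zero] using this
  -- (K5a): the limit density of `A_n`
  obtain ⟨FrZ, hZi, hZlim, hZlc, hZbd⟩ := exists_limitDensity_of_eventually_const μ𝔤 hψ
    (fun n X => ∫ k : ↥(glInt 2 F), Function.extend ((↑) : Fˣ → F) (fun u => ((χ u : ℂˣ) : ℂ)) 0 (((k : GL (Fin 2) F) : Matrix (Fin 2) (Fin 2) F)).det *
          (primePowBall F (2 * (n : ℤ)))ᶜ.indicator
            (fun y => Function.extend ((↑) : Fˣ → F) (fun u => ((χ u : ℂˣ) : ℂ)) 0 y * ((((normAbs F y)⁻¹ : ℝ≥0) : ℝ) : ℂ))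
            ((((((k : GL (Fin 2) F))⁻¹ : GL (Fin 2) F) : Matrix (Fin 2) (Fin 2) F) * X * ((k : GL (Fin 2) F) : Matrix (Fin 2) (Fin 2) F)) 1 0) ∂κ)
    (fun n => aestronglyMeasurable_twistedKAverage χ κ (hωm n) μ𝔤)
    (fun X hX => twistedKAverage_eventually_const dx χ hχ2 hχ1 _ hbridge X hX) hbound hlc
  -- (K5c): the chain
  obtain ⟨γ₀, c₀, c, c', -, -, Fr₀, hFr₀i, hFr₀lc, hFr₀bd, hchain⟩ := exists_consts_twistedOrbitalFourier_eq dx χ hψ hχ2 hχ1 μ𝔤 κ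
  refine ⟨fun X => ((c : ℂ) * γ₀ * c') * FrZ X + ((c : ℂ) * γ₀ * c₀) * Fr₀ X, ?_, fun f hf => ?_, fun X hX => ?_, fun Cset hC => ?_⟩
  · -- local integrability
    have h1 := hZi.smul ((c : ℂ) * γ₀ * c')
    have h2 := hFr₀i.smul ((c : ℂ) * γ₀ * c₀)
    simpa only [Pi.add_def, Pi.smul_def, smul_eq_mul] using h1.add h2
  · -- the representation: the chain is eventually constant and converges
    obtain ⟨n₀, hn₀⟩ := hchain f hf
    have hfFrZ : Integrable (fun X => f X * FrZ X) μ𝔤 := by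
      have := hZi.integrable_smul_left_of_hasCompactSupport hf.continuous hf.2
      simpa only [smul_eq_mul] using this
    have hfFr₀ : Integrable (fun X => f X * Fr₀ X) μ𝔤 := by
      have := hFr₀i.integrable_smul_left_of_hasCompactSupport hf.continuous hf.2
      simpa only [smul_eq_mul] using this
    have hlim : Tendsto (fun n : ℕ => ((c : ℂ) * γ₀ * c') * ∫ X, f X * ∫ k : ↥(glInt 2 F),
          Function.extend ((↑) : Fˣ → F) (fun u => ((χ u : ℂˣ) : ℂ)) 0 (((k : GL (Fin 2) F) : Matrix (Fin 2) (Fin 2) F)).det *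
            (primePowBall F (2 * (n : ℤ)))ᶜ.indicator
              (fun y => Function.extend ((↑) : Fˣ → F) (fun u => ((χ u : ℂˣ) : ℂ)) 0 y * ((((normAbs F y)⁻¹ : ℝ≥0) : ℝ) : ℂ))
              ((((((k : GL (Fin 2) F))⁻¹ : GL (Fin 2) F) : Matrix (Fin 2) (Fin 2) F) * X * ((k : GL (Fin 2) F) : Matrix (Fin 2) (Fin 2) F)) 1 0) ∂κ ∂μ𝔤 +
          ((c : ℂ) * γ₀ * c₀) * ∫ X, f X * Fr₀ X ∂μ𝔤) atTop
        (𝓝 (((c : ℂ) * γ₀ * c') * (∫ X, f X * FrZ X ∂μ𝔤) + ((c : ℂ) * γ₀ * c₀) * ∫ X, f X * Fr₀ X ∂μ𝔤)) :=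
      ((hZlim f hf).const_mul _).add tendsto_const_nhds
    have hlim' := hlim.congr' ((eventually_ge_atTop n₀).mono fun n hn => (hn₀ n hn).symm)
    have heq := tendsto_nhds_unique tendsto_const_nhds hlim'
    rw [heq]
    have hsplit : (fun X => f X * (((c : ℂ) * γ₀ * c') * FrZ X + ((c : ℂ) * γ₀ * c₀) * Fr₀ X)) =
        fun X => ((c : ℂ) * γ₀ * c') * (f X * FrZ X) + ((c : ℂ) * γ₀ * c₀) * (f X * Fr₀ X) := by
      funext X; ring
    rw [hsplit, integral_add (hfFrZ.const_mul _) (hfFr₀.const_mul _), integral_const_mul, integral_const_mul]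
  · -- local constancy on the regular set
    filter_upwards [hZlc X hX, hFr₀lc X hX] with Y hY1 hY2
    rw [hY1, hY2]
  · -- the weighted bound on compact sets
    obtain ⟨B₀, hB₀⟩ := hFr₀bd Cset hC
    refine ⟨‖(c : ℂ) * γ₀ * c'‖ * max C 0 + ‖(c : ℂ) * γ₀ * c₀‖ * B₀, fun X hXC => ?_⟩
    have hD0 : 0 ≤ ((NNReal.sqrt (normAbs F X.charpoly.discr) : ℝ≥0) : ℝ) := NNReal.coe_nonneg _
    calc ((NNReal.sqrt (normAbs F X.charpoly.discr) : ℝ≥0) : ℝ) * ‖((c : ℂ) * γ₀ * c') * FrZ X + ((c : ℂ) * γ₀ * c₀) * Fr₀ X‖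
        ≤ ((NNReal.sqrt (normAbs F X.charpoly.discr) : ℝ≥0) : ℝ) * (‖(c : ℂ) * γ₀ * c'‖ * ‖FrZ X‖ + ‖(c : ℂ) * γ₀ * c₀‖ * ‖Fr₀ X‖) := by
          refine mul_le_mul_of_nonneg_left ((norm_add_le _ _).trans ?_) hD0
          exact add_le_add (norm_mul _ _).le (norm_mul _ _).le
      _ = ‖(c : ℂ) * γ₀ * c'‖ * (((NNReal.sqrt (normAbs F X.charpoly.discr) : ℝ≥0) : ℝ) * ‖FrZ X‖) +
            ‖(c : ℂ) * γ₀ * c₀‖ * (((NNReal.sqrt (normAbs F X.charpoly.discr) : ℝ≥0) : ℝ) * ‖Fr₀ X‖) := by ring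
      _ ≤ ‖(c : ℂ) * γ₀ * c'‖ * max C 0 + ‖(c : ℂ) * γ₀ * c₀‖ * B₀ :=
          add_le_add (mul_le_mul_of_nonneg_left (hZbd X) (norm_nonneg _)) (mul_le_mul_of_nonneg_left (hB₀ X hXC) (norm_nonneg _))

end Summit.HodgeConjecture.HodgeConjecture.Cruxes.H413.K2E3GL2TwistedRegularNilpotentFourierOfKAverage

end
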